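import Summits.ValiantsHypothesis.ValiantsHypothesis.Theorems.NcBinarisation
import HarnessLib

/-!
# Binarisation preserves parse trees (LLS18 Lemma 8): `circuitPts (binz P) = combCircuitPts P`

LLS18 = Lagarde–Limaye–Srinivasan 2018. THIS FILE (no definitions): (§1) SOUNDNESS of the comb
parse trees — a circuit with NO `const` operand and NO empty product computes the sum of the
terms of its comb parse trees, for product gates of ANY fan-in (`ptVal_combCircuitPts`, LLS18 §2
«the polynomial computed by C is the sum over its parse formulas»); (§2) the binarisation keeps
the model: product fan-in 1 or 2 (`binz_prod_length`), no `const` operand (`binz_noConst`,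
`binz_output`); (§3) the PARSE-TREE IDENTITY `circuitPts (binz P) = combCircuitPts P`
(`circuitPts_binz`, UNCONDITIONAL: the parse trees of the binarised circuit, shapes AND terms, are
literally the comb parse trees of `P` — LLS18 Lemma 8 «the parse formulas of C′ are obtained from
those of C by the same replacement») and hence `(binz P).ncEval = P.ncEval` (`ncEval_binz`).
Proof of §3 = the slot invariant `ptLists_binBlocks` (slot `btbl G j` holds the comb parse trees of
gate `j`; earlier references land in earlier blocks by T1 `btbl_lt_boff`, later / dangling ones
beyond the current slot by T2 `boff_succ_le_btbl`, where both sides read `[]`).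
MODEL (the sentence of bus OFFER 2482 / CALL 2483, VERBATIM): «Circuits ArithCircuit R σ read in
FreeAlgebra R σ (ncEval): weighted sum gates of any fan-in, ORDERED product gates of ANY fan-in; NO
`const` operands (print: inputs are variables, constants live on the + wires, LLS18 p. 7) and, for
the value theorems, NO EMPTY products (prod [] computes 1, which has no parse tree). A parse tree
keeps one summand of every sum gate and ALL factors of every product gate; a k-ary product node is
RECORDED as its left comb ((t₁t₂)t₃)⋯t_k in the binary Shape (fan-in 1 transparent, fan-in 2 = the
landed circuitPts, LITERAL agreement combCircuitPts P = circuitPts P when all product fan-ins ≤ 2).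
PRINT-UPT of shape T (LLS18 §3, any fan-in) ⇒ comb-UPT (all comb parse trees have one shape, the
comb of T); NOT conversely (the encoding forgets arities) — so every bound stated against comb-UPT
circuits IS a bound against print-UPT circuits of arbitrary product fan-in, size measured by gates +
wires (print measures wires). Comb-rotUPT is a KERNEL class: = print-rotUPT (LLS18 §4) at fan-in ≤
2, INCOMPARABLE with it at fan-in ≥ 3 (reordering three children is not a rotation of the comb:
comb_rot_witness) — the Rot statements are NOT print-rotUPT for fan-in ≥ 3. binz = LLS18 Lemma 8's
chain of k−1 binary products with references renumbered by prefix sums; (binz P).size = Σ max(1,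
fanIn−1) ≤ P.size + P.edgeSize. The constants are those of the landed transfers (WEAKER than the
typed rungs). NOT a new lower bound; 0 S-currency; closes NO item; A_nc stmt-23446 / PerNotNcVP / VP
≠ VNP untouched.»
[cite: LagardeLimayeSrinivasan2018, §2 (p. 7–8), §3 Lemma 8 (p. 9)]
[cite: LimayeMalodSrinivasan2016, §7]
-/

noncomputable section

namespace Summit.ValiantsHypothesis.ValiantsHypothesis.Theorems.NcBinarisationParseTrees

set_option linter.dupNamespace false
open Literature.Computability.AlgebraicComplexity
  Literature.Computability.AlgebraicComplexity.ArithCircuit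
  Summit.ValiantsHypothesis.ValiantsHypothesis.Theorems.NcAutomatonIntersection
  Summit.ValiantsHypothesis.ValiantsHypothesis.Theorems.NcUniqueParseTree
  Summit.ValiantsHypothesis.ValiantsHypothesis.Theorems.NcParseTrees
  Summit.ValiantsHypothesis.ValiantsHypothesis.Theorems.NcParseTreeValues
  Summit.ValiantsHypothesis.ValiantsHypothesis.Theorems.NcBinarisation

universe u v

variable {R : Type u} {σ : Type v}

section Sound
variable [CommSemiring R]

/-! ### §1 Soundness of the comb parse trees (any product fan-in) -/

/-- Chains: value = accumulated value times the ordered product of the factors.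
[cite: LagardeLimayeSrinivasan2018, §2] -/
theorem ptVal_chainPts {W : List (List (Shape × FreeAlgebra R σ))} {vals : List (FreeAlgebra R σ)}
    (hW : ∀ j, ptVal (W.getD j []) = vals.getD j 0) (acc : List (Shape × FreeAlgebra R σ))
    (rest : List (Operand R σ)) (hc : ∀ u ∈ rest, ∀ c, u ≠ Operand.const c) :
    ptVal (chainPts W acc rest) = ptVal acc * (rest.map fun u => u.ncEval vals).prod := by
  induction rest generalizing acc with
  | nil => simp [chainPts]
  | cons u rest ih =>
    rw [chainPts_cons, ih _ fun v hv => hc v (by simp [hv]), ptVal_pairPts,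
      ptVal_opPts hW u (hc u (by simp)), List.map_cons, List.prod_cons, mul_assoc]

/-- Gates: value = sum of comb parse trees (no constants, no empty product).
[cite: LagardeLimayeSrinivasan2018, §2] -/
theorem ptVal_combGatePts {W : List (List (Shape × FreeAlgebra R σ))} {vals : List (FreeAlgebra R σ)}
    (hW : ∀ j, ptVal (W.getD j []) = vals.getD j 0) (g : Gate R σ)
    (hc : ∀ u ∈ g.args, ∀ c, u ≠ Operand.const c) (hp : ∀ args, g = Gate.prod args → args ≠ []) :
    ptVal (combGatePts W g) = g.ncEval vals := by
  rcases g with args | (_ | ⟨u, rest⟩)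
  · exact ptVal_sumPts hW args fun a ha => hc a.2 (by
      simp only [Gate.args]; exact List.mem_map.2 ⟨a, ha, rfl⟩)
  · exact absurd rfl (hp [] rfl)
  · show ptVal (chainPts W (opPts W u) rest) = _
    rw [ptVal_chainPts hW _ rest fun v hv => hc v (by simp [Gate.args, hv]),
      ptVal_opPts hW u (hc u (by simp [Gate.args]))]
    simp [Gate.ncEval]

/-- Gate lists: slot by slot. [cite: LagardeLimayeSrinivasan2018, §2] -/
theorem ptVal_combPtLists (gs : List (Gate R σ))
    (hc : ∀ g ∈ gs, ∀ u ∈ g.args, ∀ c, u ≠ Operand.const c)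
    (hp : ∀ args, Gate.prod args ∈ gs → args ≠ []) (j : ℕ) :
    ptVal ((combPtLists gs).getD j []) = (ncGateValues gs).getD j 0 := by
  induction gs using List.reverseRecOn generalizing j with
  | nil => simp [combPtLists, ncGateValues, ptVal]
  | append_singleton gs g ih =>
    have ih' : ∀ j, ptVal ((combPtLists gs).getD j []) = (ncGateValues gs).getD j 0 := fun j =>
      ih (fun g' hg' => hc g' (List.mem_append_left _ hg'))
        (fun args h => hp args (List.mem_append_left _ h)) j
    rcases Nat.lt_trichotomy j gs.length with hj | rfl | hj
    · rw [combPtLists_getD_append gs [g] hj, (ncGateValues_append_getD gs [g]).2 j hj, ih' j]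
    · rw [ncGateValues_getD_length, combPtLists_append_singleton,
        List.getD_append_right _ _ _ _ (length_combPtLists gs).le, length_combPtLists, Nat.sub_self,
        List.getD_cons_zero]
      exact ptVal_combGatePts ih' g (hc g (by simp)) fun args h => hp args (by rw [← h]; simp)
    · have h1 : (combPtLists (gs ++ [g])).length ≤ j := by
        rw [length_combPtLists, List.length_append, List.length_singleton]; omega
      have h2 : (ncGateValues (gs ++ [g])).length ≤ j := by
        rw [(ncGateValues_append_getD gs [g]).1, List.length_singleton]; omega
      rw [List.getD_eq_default _ _ h1, List.getD_eq_default _ _ h2]; simp [ptVal]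

/-- ★ **SOUNDNESS FOR ANY PRODUCT FAN-IN** (LLS18 §2): a circuit with no `const` operand and no
empty product computes the sum of the terms of its comb parse trees. MODEL (the comb MODEL of
`NcBinarisation`); NOT a new lower bound; 0 S-currency; closes NO item; A_nc stmt-23446 /
`PerNotNcVP` / VP ≠ VNP untouched. [cite: LagardeLimayeSrinivasan2018, §2] -/
theorem ptVal_combCircuitPts (P : ArithCircuit R σ)
    (hc : ∀ g ∈ P.gates, ∀ u ∈ g.args, ∀ c, u ≠ Operand.const c)
    (hp : ∀ args, Gate.prod args ∈ P.gates → args ≠ [])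
    (ho : ∀ c, P.output ≠ Operand.const c) : ptVal (combCircuitPts P) = P.ncEval :=
  ptVal_opPts (ptVal_combPtLists P.gates hc hp) P.output ho

end Sound

/-! ### §2 The binarisation keeps the model (purely syntactic) -/

/-- [cite: LagardeLimayeSrinivasan2018, §3 Lemma 8] -/
theorem mem_chainGates {tbl : ℕ → ℕ} {p : ℕ} {rest : List (Operand R σ)} {g : Gate R σ}
    (hg : g ∈ chainGates tbl p rest) : ∃ q, ∃ u ∈ rest, g = Gate.prod [.gate q, bop tbl u] := by
  induction rest generalizing p with
  | nil => simp [chainGates] at hg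
  | cons u rest ih =>
    rw [chainGates_cons, List.mem_cons] at hg
    rcases hg with rfl | hg
    · exact ⟨p, u, by simp, rfl⟩
    · obtain ⟨q, v, hv, rfl⟩ := ih hg
      exact ⟨q, v, by simp [hv], rfl⟩

/-- [cite: LagardeLimayeSrinivasan2018, §3 Lemma 8] -/
theorem mem_binBlocks {tbl : ℕ → ℕ} {pos : ℕ} {gs : List (Gate R σ)} {g' : Gate R σ}
    (h : g' ∈ binBlocks tbl pos gs) : ∃ g ∈ gs, ∃ pos', g' ∈ block tbl pos' g := by
  induction gs generalizing pos with
  | nil => simp [binBlocks] at h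
  | cons g gs ih =>
    rw [binBlocks_cons, List.mem_append] at h
    rcases h with h | h
    · exact ⟨g, by simp, pos, h⟩
    · obtain ⟨g₁, hg₁, pos', h'⟩ := ih h
      exact ⟨g₁, by simp [hg₁], pos', h'⟩

/-- Product gates of a block have fan-in 1 or 2 (source products non-empty).
[cite: LagardeLimayeSrinivasan2018, §3 Lemma 8] -/
theorem block_prod_length {tbl : ℕ → ℕ} {pos : ℕ} {g : Gate R σ}
    (hg : ∀ args, g = Gate.prod args → args ≠ []) {args : List (Operand R σ)}
    (h : Gate.prod args ∈ block tbl pos g) : args.length = 1 ∨ args.length = 2 := by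
  rcases g with xs | (_ | ⟨u, _ | ⟨u', rest⟩⟩)
  · simp [block] at h
  · exact absurd rfl (hg [] rfl)
  · simp only [block, List.mem_singleton, Gate.prod.injEq] at h
    subst h; simp
  · rw [show block tbl pos (Gate.prod (u :: u' :: rest)) =
        Gate.prod [bop tbl u, bop tbl u'] :: chainGates tbl pos rest from rfl, List.mem_cons] at h
    rcases h with h | h
    · rw [Gate.prod.injEq] at h
      subst h; simp
    · obtain ⟨q, v, _, hv⟩ := mem_chainGates h
      rw [Gate.prod.injEq] at hv
      subst hv; simp

/-- Blocks introduce no `const` operand. [cite: LagardeLimayeSrinivasan2018, §3 Lemma 8] -/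
theorem block_noConst {tbl : ℕ → ℕ} {pos : ℕ} {g : Gate R σ}
    (hc : ∀ u ∈ g.args, ∀ c, u ≠ Operand.const c) {g' : Gate R σ} (h : g' ∈ block tbl pos g) :
    ∀ u ∈ g'.args, ∀ c, u ≠ Operand.const c := by
  rcases g with xs | (_ | ⟨u, _ | ⟨u', rest⟩⟩)
  · simp only [block, List.mem_singleton] at h
    subst h
    simp only [Gate.args, List.map_map, List.forall_mem_map, Function.comp]
    intro a ha
    exact bop_ne_const tbl (hc a.2 (by simp only [Gate.args]; exact List.mem_map.2 ⟨a, ha, rfl⟩))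
  · simp only [block, List.mem_singleton] at h
    subst h; simp [Gate.args]
  · simp only [block, List.mem_singleton] at h
    subst h
    intro v hv
    simp only [Gate.args, List.mem_singleton] at hv
    subst hv
    exact bop_ne_const tbl (hc u (by simp [Gate.args]))
  · rw [show block tbl pos (Gate.prod (u :: u' :: rest)) =
        Gate.prod [bop tbl u, bop tbl u'] :: chainGates tbl pos rest from rfl, List.mem_cons] at h
    rcases h with rfl | h
    · intro v hv
      simp only [Gate.args, List.mem_cons, List.not_mem_nil, or_false] at hv
      rcases hv with rfl | rfl
      · exact bop_ne_const tbl (hc u (by simp [Gate.args]))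
      · exact bop_ne_const tbl (hc u' (by simp [Gate.args]))
    · obtain ⟨q, v, hv, rfl⟩ := mem_chainGates h
      intro w hw
      simp only [Gate.args, List.mem_cons, List.not_mem_nil, or_false] at hw
      rcases hw with rfl | rfl
      · simp
      · exact bop_ne_const tbl (hc v (by simp [Gate.args, hv]))

/-- ★ Every product gate of `binz P` has fan-in 1 or 2 (source products non-empty). MODEL
(module docstring); NOT a new lower bound; 0 S-currency; closes NO item; A_nc stmt-23446 / PerNotNcVP / VP ≠ VNP untouched.
[cite: LagardeLimayeSrinivasan2018, §3 Lemma 8] -/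
theorem binz_prod_length (P : ArithCircuit R σ)
    (hp : ∀ args, Gate.prod args ∈ P.gates → args ≠ []) (args : List (Operand R σ))
    (h : Gate.prod args ∈ (binz P).gates) : args.length = 1 ∨ args.length = 2 := by
  obtain ⟨g, hg, pos', h'⟩ := mem_binBlocks h
  exact block_prod_length (fun xs hxs => hp xs (hxs ▸ hg)) h'

/-- ★ `binz P` has no `const` operand if `P` has none. MODEL (module docstring);
NOT a new lower bound; 0 S-currency; closes NO item; A_nc stmt-23446 / PerNotNcVP / VP ≠ VNP untouched.
[cite: LagardeLimayeSrinivasan2018, §3 Lemma 8] -/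
theorem binz_noConst (P : ArithCircuit R σ)
    (hc : ∀ g ∈ P.gates, ∀ u ∈ g.args, ∀ c, u ≠ Operand.const c) (g' : Gate R σ)
    (h : g' ∈ (binz P).gates) : ∀ u ∈ g'.args, ∀ c, u ≠ Operand.const c := by
  obtain ⟨g, hg, pos', h'⟩ := mem_binBlocks h
  exact block_noConst (hc g hg) h'

/-- ★ The output of `binz P` is not a constant if `P`'s is not. MODEL (module docstring);
NOT a new lower bound; 0 S-currency; closes NO item; A_nc stmt-23446 / PerNotNcVP / VP ≠ VNP untouched.
[cite: LagardeLimayeSrinivasan2018, §3 Lemma 8] -/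
theorem binz_output (P : ArithCircuit R σ) (ho : ∀ c, P.output ≠ Operand.const c) (c : R) :
    (binz P).output ≠ Operand.const c :=
  bop_ne_const _ ho c

section Identity
variable [CommSemiring R]

/-! ### §3 The slot invariant and the parse-tree identity -/

/-- Renumbered operands read the comb lists: earlier references hit their block's last slot,
later / dangling ones read `[]` on both sides. [cite: LagardeLimayeSrinivasan2018, §3 Lemma 8] -/
theorem opPts_bop {W W' : List (List (Shape × FreeAlgebra R σ))} {tbl : ℕ → ℕ} {m : ℕ}
    (h1 : ∀ j, j < m → W'.getD (tbl j) [] = W.getD j [])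
    (h2 : ∀ j, m ≤ j → W'.length ≤ tbl j) (hW : W.length = m) (u : Operand R σ) :
    opPts W' (bop tbl u) = opPts W u := by
  cases u with
  | var x => rfl
  | const c => rfl
  | gate j =>
    simp only [bop, opPts]
    rcases Nat.lt_or_ge j m with hj | hj
    · exact h1 j hj
    · rw [List.getD_eq_default _ _ (h2 j hj), List.getD_eq_default _ _ (by omega)]

/-- … and so do renumbered sums. [cite: LagardeLimayeSrinivasan2018, §3 Lemma 8] -/
theorem sumPts_bop {W W' : List (List (Shape × FreeAlgebra R σ))} {tbl : ℕ → ℕ} {m : ℕ}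
    (h1 : ∀ j, j < m → W'.getD (tbl j) [] = W.getD j [])
    (h2 : ∀ j, m ≤ j → W'.length ≤ tbl j) (hW : W.length = m) (args : List (R × Operand R σ)) :
    sumPts W' (args.map fun a => (a.1, bop tbl a.2)) = sumPts W args := by
  induction args with
  | nil => rfl
  | cons a args ih => simp only [List.map_cons, sumPts, opPts_bop h1 h2 hW, ih]

/-- The newest slot. [cite: LagardeLimayeSrinivasan2018, §2] -/
theorem ptLists_getD_length (B : List (Gate R σ)) (s : Gate R σ) :
    (ptLists (B ++ [s])).getD B.length [] = gatePts (ptLists B) s := by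
  rw [ptLists_append_singleton, List.getD_append_right _ _ _ _ (length_ptLists B).le,
    length_ptLists, Nat.sub_self, List.getD_cons_zero]

/-- CHAIN INVARIANT: appended after gates `B` whose last slot holds `acc`, the chain of `rest`
ends in a slot holding `chainPts W acc rest`. [cite: LagardeLimayeSrinivasan2018, §3 Lemma 8] -/
theorem ptLists_chainGates {W : List (List (Shape × FreeAlgebra R σ))} {tbl : ℕ → ℕ} {m : ℕ}
    (hW : W.length = m) (B : List (Gate R σ)) (hB : 1 ≤ B.length)
    (h0 : ∀ j, j < m → tbl j < B.length)
    (h1 : ∀ j, j < m → (ptLists B).getD (tbl j) [] = W.getD j [])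
    (acc : List (Shape × FreeAlgebra R σ)) (hacc : (ptLists B).getD (B.length - 1) [] = acc)
    (rest : List (Operand R σ)) (h2 : ∀ j, m ≤ j → B.length - 1 + rest.length ≤ tbl j) :
    (ptLists (B ++ chainGates tbl (B.length - 1) rest)).getD (B.length - 1 + rest.length) [] =
      chainPts W acc rest := by
  induction rest using List.reverseRecOn with
  | nil => simpa [chainGates, chainPts] using hacc
  | append_singleton rest u ih =>
    have ih' := ih fun j hj => by
      have := h2 j hj
      simp only [List.length_append, List.length_singleton] at this
      omega
    have hC : (ptLists (B ++ chainGates tbl (B.length - 1) rest)).length = B.length + rest.length := by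
      rw [length_ptLists, List.length_append, length_chainGates]
    rw [chainGates_append, ← List.append_assoc, ptLists_append_singleton, List.length_append,
      List.length_singleton,
      show B.length - 1 + (rest.length + 1) =
        (ptLists (B ++ chainGates tbl (B.length - 1) rest)).length by rw [hC]; omega,
      List.getD_append_right _ _ _ _ le_rfl, Nat.sub_self, List.getD_cons_zero,
      chainPts_append_singleton, ← ih']
    simp only [gatePts]
    rw [opPts_bop (fun j hj => by rw [ptLists_getD_append _ _ (h0 j hj), h1 j hj])
      (fun j hj => by rw [hC]; have := h2 j hj; simp only [List.length_append,
        List.length_singleton] at this; omega) hW u]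
    rfl

/-- BLOCK INVARIANT: appended after gates `B`, the block of `g` ends in a slot holding the comb
parse trees of `g` read from `W` (the comb lists so far), provided earlier references are
renumbered into `B` with the right contents and later ones beyond the block.
[cite: LagardeLimayeSrinivasan2018, §3 Lemma 8] -/
theorem ptLists_block {W : List (List (Shape × FreeAlgebra R σ))} {tbl : ℕ → ℕ} {m : ℕ}
    (hW : W.length = m) (B : List (Gate R σ)) (g : Gate R σ)
    (h0 : ∀ j, j < m → tbl j < B.length)
    (h1 : ∀ j, j < m → (ptLists B).getD (tbl j) [] = W.getD j [])
    (h2 : ∀ j, m ≤ j → B.length + width g - 1 ≤ tbl j) :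
    (ptLists (B ++ block tbl B.length g)).getD (B.length + width g - 1) [] = combGatePts W g := by
  have h2' : ∀ j, m ≤ j → (ptLists B).length ≤ tbl j := fun j hj => by
    rw [length_ptLists]; have := h2 j hj; have := one_le_width g; omega
  have hop : ∀ u, opPts (ptLists B) (bop tbl u) = opPts W u := opPts_bop h1 h2' hW
  rcases g with args | (_ | ⟨u, _ | ⟨u', rest⟩⟩)
  · simp only [block, width, Nat.add_sub_cancel, ptLists_getD_length]
    exact sumPts_bop h1 h2' hW args
  · simp only [block, width, Nat.add_sub_cancel, ptLists_getD_length]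
    rfl
  · simp only [block, width, Nat.add_sub_cancel, ptLists_getD_length]
    exact hop u
  · have e1 : B ++ block tbl B.length (Gate.prod (u :: u' :: rest)) =
        (B ++ [Gate.prod [bop tbl u, bop tbl u']]) ++
          chainGates tbl ((B ++ [Gate.prod [bop tbl u, bop tbl u']]).length - 1) rest := by
      simp [block]
    have e2 : B.length + width (Gate.prod (u :: u' :: rest)) - 1 =
        (B ++ [Gate.prod [bop tbl u, bop tbl u']]).length - 1 + rest.length := by
      simp only [width, List.length_append, List.length_singleton]; omega
    rw [e1, e2, ptLists_chainGates hW (B ++ [Gate.prod [bop tbl u, bop tbl u']]) (by simp)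
      (fun j hj => by rw [List.length_append]; exact Nat.lt_add_right _ (h0 j hj))
      (fun j hj => by rw [ptLists_getD_append _ _ (h0 j hj), h1 j hj])
      (pairPts (opPts W u) (opPts W u')) (by
        rw [List.length_append, List.length_singleton, Nat.add_sub_cancel, ptLists_getD_length]
        simp only [gatePts, hop]) rest
      (fun j hj => by
        have := h2 j hj
        simp only [width, List.length_append, List.length_singleton] at this ⊢; omega)]
    rfl

/-- LAYOUT INVARIANT: after the blocks of the first `m` gates of `G` there are `boff G m` slots,
and slot `btbl G j` (`j < m`) holds the comb parse trees of gate `j`.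
[cite: LagardeLimayeSrinivasan2018, §3 Lemma 8] -/
theorem ptLists_binBlocks (G : List (Gate R σ)) (m : ℕ) (hm : m ≤ G.length) :
    (binBlocks (btbl G) 0 (G.take m)).length = boff G m ∧
      ∀ j, j < m → (ptLists (binBlocks (btbl G) 0 (G.take m))).getD (btbl G j) [] =
        (combPtLists (G.take m)).getD j [] := by
  induction m with
  | zero => simp [binBlocks, boff]
  | succ m ih =>
    obtain ⟨hlen, hval⟩ := ih (Nat.le_of_succ_le hm)
    have hmG : m < G.length := hm
    have hWm : (combPtLists (G.take m)).length = m := by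
      rw [length_combPtLists, List.length_take]; omega
    rw [List.take_succ_eq_append_getElem hmG, binBlocks_append, Nat.zero_add,
      show ((G.take m).map width).sum = (binBlocks (btbl G) 0 (G.take m)).length from hlen.symm]
    refine ⟨by rw [List.length_append, length_block, hlen, boff_succ G hmG], fun j hj => ?_⟩
    rcases Nat.lt_succ_iff_lt_or_eq.1 hj with hj | hj
    · rw [ptLists_getD_append _ _ (by rw [hlen]; exact btbl_lt_boff G hj hmG.le),
        combPtLists_getD_append _ _ (by rw [List.length_take]; omega), hval j hj]
    · subst j
      rw [show btbl G m = (binBlocks (btbl G) 0 (G.take m)).length + width G[m] - 1 by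
          rw [hlen, btbl, List.getD_eq_getElem _ _ hmG],
        combPtLists_append_singleton, List.getD_append_right _ _ _ _ hWm.le, hWm, Nat.sub_self,
        List.getD_cons_zero]
      exact ptLists_block hWm _ G[m] (fun j' hj' => by rw [hlen]; exact btbl_lt_boff G hj' hmG.le)
        hval fun j' hj' => by
          have h := boff_succ_le_btbl G hj' hmG
          rw [boff_succ G hmG] at h
          rw [hlen]; omega

/-- ★★ **THE BINARISATION PRESERVES PARSE TREES** (LLS18 Lemma 8), UNCONDITIONALLY: the parse
trees of `binz P` (shapes and terms, as a list) are the comb parse trees of `P`. Hence comb-UPT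
of shape `T` for `P` (in particular PRINT-UPT with product gates of any fan-in) is print-UPT of
shape `T` for the fan-in-≤-2 circuit `binz P`, and comb-rotUPT is print-rotUPT of `binz P`.
MODEL (the comb / binarisation MODEL of `NcBinarisation`); NOT a new lower bound; 0 S-currency;
closes NO item; A_nc stmt-23446 / `PerNotNcVP` / VP ≠ VNP untouched.
[cite: LagardeLimayeSrinivasan2018, §3 Lemma 8] -/
theorem circuitPts_binz (P : ArithCircuit R σ) : circuitPts (binz P) = combCircuitPts P := by
  obtain ⟨hlen, hval⟩ := ptLists_binBlocks P.gates P.gates.length le_rfl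
  rw [List.take_length] at hlen hval
  show opPts (ptLists (binBlocks (btbl P.gates) 0 P.gates)) (bop (btbl P.gates) P.output) =
    opPts (combPtLists P.gates) P.output
  exact opPts_bop hval (fun j hj => by
      rw [length_ptLists, hlen, ← boff_of_length_le P.gates hj]; exact boff_le_btbl P.gates j)
    (length_combPtLists P.gates) P.output

/-- ★★ **THE BINARISATION PRESERVES THE VALUE** (LLS18 Lemma 8): no `const` operand, no empty
product ⇒ `(binz P).ncEval = P.ncEval`. MODEL (the comb / binarisation MODEL of
`NcBinarisation`); NOT a new lower bound; 0 S-currency; closes NO item; A_nc stmt-23446 /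
`PerNotNcVP` / VP ≠ VNP untouched. [cite: LagardeLimayeSrinivasan2018, §3 Lemma 8] -/
theorem ncEval_binz (P : ArithCircuit R σ)
    (hc : ∀ g ∈ P.gates, ∀ u ∈ g.args, ∀ c, u ≠ Operand.const c)
    (hp : ∀ args, Gate.prod args ∈ P.gates → args ≠ [])
    (ho : ∀ c, P.output ≠ Operand.const c) : (binz P).ncEval = P.ncEval := by
  rw [← ptVal_circuitPts (binz P) (binz_noConst P hc) (binz_prod_length P hp) (binz_output P ho),
    circuitPts_binz, ptVal_combCircuitPts P hc hp ho]

end Identity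

end Summit.ValiantsHypothesis.ValiantsHypothesis.Theorems.NcBinarisationParseTrees
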